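import Summits.Ventures.HSemireg.WedgeKunnethKernel

/-!
# Venture HSemireg — THE KÜNNETH KERNEL LAW (2/2): the kernel co-polynomial law, NON-DEGENERATE factors, and the degree-2
# kernel of a box of any number of them — `Kr(⋃_i D_i, f₀ ∧ ⋯ ∧ f_{n−1}, 2) = ⊕_i Kr(D_i, f_i, 2)`

HONEST FRAMING. Part of the Lean index of the computation cell `pub-hsemireg` (seat p10 gen 13, Sunday typer «UNIFORM-IN-n»).
Finite-dimensional EXTERIOR ALGEBRA over a field ONLY: no variety, no cohomology theory, no sheaf, no Ext group and no
semiregularity map is constructed here; nothing here says that HC / HC_CM / HC_AV holds; no Literature fact is declared or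
used.  Custodian versions cited: theory/FORMULA-N.md PART A §2.3 THEOREM K, PART B §A.3 / §N.3 / §N.7 (a), th-7 Cor. A.4 (the
degree-2 kernel of the box of two point objects is `H¹(T_X) ⊗ 1 ⊕ 1 ⊗ H¹(T_{X′})`); STRUCTURE.md v1.0-SIGNED 9b196a05977dd067 §1.1
rows C4 / C10.  The dictionary is QUOTED from those files, never asserted.

WHAT IS KEYED.  `WedgeKunnethKernel` (this seat, 1/2): the factor kernel spaces `Kr(D, f, a) = {θ ∈ Hom(D,a) : θ ∧ f = 0}`, the
Künneth kernel sum `krSum`, and THE KÜNNETH KERNEL LAW `Kr(D₁ ⊔ D₂, f₁f₂, k) = Σ_{a+b=k} ( Kr(D₁,f₁,a) ∧ Hom(D₂,b) + Hom(D₁,a) ∧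
Kr(D₂,f₂,b) )`.  THIS FILE:
* §1 BOOKKEEPING: **`finrank_Kr_union_add`: `dim Kr(D₁ ⊔ D₂, f₁f₂, k) + Σ_{a+b=k} r_a(f₁) r_b(f₂) = C(|D₁| + |D₂|, k)`** and the
  KERNEL CO-POLYNOMIAL LAW **`finrank_Kr_union_add_sum`: `κ(k) + Σ_{a+b=k} κ₁(a)κ₂(b) = Σ_{a+b=k} ( κ₁(a)·C(|D₂|,b) + C(|D₁|,a)·κ₂(b) )`**
  (`κ = dim Kr`; inclusion–exclusion of the two summands of the Künneth kernel sum).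
* §2 LOW DEGREES: `Hom(D, 0) = 1`, `Kr(D, f, 0) = 0 ⟺ f ≠ 0`; the Künneth kernel sum in degrees `0, 1, 2` spelled out; for two
  NON-DEGENERATE factors (non-zero and killed by no `1`-form: `Kr(D_i, f_i, 1) = 0`) the product is non-degenerate
  (`Kr_union_zero_eq_bot` — so **`mul_ne_zero_of_mem_Hom`: `f₁ ∧ f₂ ≠ 0`** —, `Kr_union_one_eq_bot`) and **`Kr_union_two_eq`:
  `Kr(D₁ ⊔ D₂, f₁f₂, 2) = Kr(D₁, f₁, 2) ⊕ Kr(D₂, f₂, 2)`** (direct: `Kr_two_inf_Kr_two_eq_bot`; dimensions add: `finrank_Kr_union_two`) —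
  th-7 Cor. A.4's shape «`H¹(T_X) ⊗ 1 ⊕ 1 ⊗ H¹(T_{X′})`» for ARBITRARY homogeneous classes killed by no `1`-form: the mixed Künneth
  directions `Hom(D₁, 1) ∧ Hom(D₂, 1)` NEVER meet the degree-2 kernel.
* §3 ANY FINITE SPLITTING (gen 6's ordered products `prodR` over pairwise disjoint blocks `D 0, …, D (n−1)`): the recursive kernel law
  **`Kr_prodR_succ`** in every degree; prefix products of non-degenerate factors are non-degenerate (`Kr_prodR_low`); and **`Kr_prodR_two`:
  `Kr(⋃_{i<j} D_i, f 0 ∧ ⋯ ∧ f (j−1), 2) = ⊔_{i<j} Kr(D_i, f_i, 2)`** for every `1 ≤ j ≤ n`, of dimension `Σ_{i<j} dim Kr(D_i, f_i, 2)`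
  (`finrank_Kr_prodR_two`) — uniformly in the number of factors, their blocks and their degrees.
In the quoted dictionary: for an external product `E₀ ⊠ ⋯ ⊠ E_{n−1}` of objects whose classes are killed by no `1`-form (for `K[Θ]`-classes:
not PURE), the degree-2 kernel of `⌟ch` on `HT²` is the direct sum of the factors' degree-2 kernels — no mixed direction
`H^a(∧^bT_{X_i}) ⊗ H^{a′}(∧^{b′}T_{X_j})`, `i ≠ j`, `a+b = a′+b′ = 1`, is ever killed.  NOT typed here: the Hankel specialisation; anything
Ext-side.  Class side only.  Namespace `Summit.Ventures.HSemireg.Wedge.KunnethKernel` (continued); new names only.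
-/

open Module

namespace Summit.Ventures.HSemireg.Wedge.KunnethKernel

open Summit.Ventures.HSemireg.Wedge Summit.Ventures.HSemireg.Wedge.Kunneth Summit.Ventures.HSemireg.Wedge.MixedBox

variable (K : Type*) [Field K] {I : Type*} [LinearOrder I] [Fintype I]

/-! ## §1. Bookkeeping: the kernel co-polynomial law -/

/-- **KERNEL–RANK BOOKKEEPING ON A PRODUCT: `dim Kr(D₁ ⊔ D₂, f₁f₂, k) + Σ_{a ≤ k} r_a(f₁)·r_{k−a}(f₂) = C(|D₁| + |D₂|, k)`**
(THEOREM K_lin + rank–nullity). -/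
theorem finrank_Kr_union_add {D₁ D₂ : Finset I} (hD : Disjoint D₁ D₂) {d₁ d₂ : ℕ} {f₁ f₂ : HT K I}
    (hf₁ : f₁ ∈ Hom K I D₁ d₁) (hf₂ : f₂ ∈ Hom K I D₂ d₂) (k : ℕ) :
    finrank K (Kr K (D₁ ∪ D₂) (f₁ * f₂) k) +
        ∑ a ∈ Finset.range (k + 1), finrank K (V K I D₁ f₁ a) * finrank K (V K I D₂ f₂ (k - a)) =
      (D₁.card + D₂.card).choose k := by
  rw [← finrank_V_mul K hD hf₁ hf₂ k, finrank_Kr_add_finrank_V, Finset.card_union_of_disjoint hD]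

/-- Vandermonde in range form: `C(M + N, k) = Σ_{a ≤ k} C(M, a)·C(N, k − a)`. -/
private lemma add_choose_eq_sum_range' (M N k : ℕ) :
    (M + N).choose k = ∑ a ∈ Finset.range (k + 1), M.choose a * N.choose (k - a) := by
  rw [Nat.add_choose_eq, Finset.Nat.sum_antidiagonal_eq_sum_range_succ (fun a b => M.choose a * N.choose b)]

/-- **THE KERNEL CO-POLYNOMIAL LAW: `κ(k) + Σ_{a+b=k} κ₁(a)·κ₂(b) = Σ_{a+b=k} ( κ₁(a)·C(|D₂|, b) + C(|D₁|, a)·κ₂(b) )`**, `κ = dim Kr`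
(inclusion–exclusion of the two summands of the Künneth kernel sum, whose intersection in bidegree `(a, b)` has dimension
`κ₁(a)κ₂(b)`; here as pure bookkeeping from the rank law). -/
theorem finrank_Kr_union_add_sum {D₁ D₂ : Finset I} (hD : Disjoint D₁ D₂) {d₁ d₂ : ℕ} {f₁ f₂ : HT K I}
    (hf₁ : f₁ ∈ Hom K I D₁ d₁) (hf₂ : f₂ ∈ Hom K I D₂ d₂) (k : ℕ) :
    finrank K (Kr K (D₁ ∪ D₂) (f₁ * f₂) k) +
        ∑ a ∈ Finset.range (k + 1), finrank K (Kr K D₁ f₁ a) * finrank K (Kr K D₂ f₂ (k - a)) =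
      ∑ a ∈ Finset.range (k + 1),
        (finrank K (Kr K D₁ f₁ a) * D₂.card.choose (k - a) + D₁.card.choose a * finrank K (Kr K D₂ f₂ (k - a))) := by
  have h := finrank_Kr_union_add K hD hf₁ hf₂ k
  rw [add_choose_eq_sum_range'] at h
  -- termwise: C₁C₂ + κ₁κ₂ = r₁r₂ + (κ₁C₂ + C₁κ₂), with C = κ + r on each factor
  have ht : ∀ a ∈ Finset.range (k + 1), D₁.card.choose a * D₂.card.choose (k - a) +
      finrank K (Kr K D₁ f₁ a) * finrank K (Kr K D₂ f₂ (k - a)) =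
      finrank K (V K I D₁ f₁ a) * finrank K (V K I D₂ f₂ (k - a)) +
      (finrank K (Kr K D₁ f₁ a) * D₂.card.choose (k - a) + D₁.card.choose a * finrank K (Kr K D₂ f₂ (k - a))) := by
    intro a _
    have h1 := finrank_Kr_add_finrank_V K D₁ f₁ a
    have h2 := finrank_Kr_add_finrank_V K D₂ f₂ (k - a)
    rw [← h1, ← h2]
    ring
  have hs := Finset.sum_congr rfl ht
  rw [Finset.sum_add_distrib, Finset.sum_add_distrib] at hs
  omega

/-! ## §2. Low degrees: non-degenerate factors, and the degree-2 kernel of a box of two of them -/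

/-- the empty monomial is `1` (any generator type). -/
private lemma B_empty_gen : B K I (∅ : Finset I) = 1 := by
  rw [B, ExteriorAlgebra.basis_apply_ofCard (b K I) (Finset.card_empty)]
  simp [ExteriorAlgebra.ιMulti_family]

/-- `Hom(D, 0) = 1 = K · 1` as a subspace. -/
lemma Hom_zero_eq_one (D : Finset I) : Hom K I D 0 = (1 : Submodule K (HT K I)) := by
  rw [Submodule.one_eq_span, Hom]
  congr 1
  ext x
  simp only [Set.mem_image, Set.mem_setOf_eq, Finset.card_eq_zero, Set.mem_singleton_iff]
  constructor
  · rintro ⟨s, ⟨-, rfl⟩, rfl⟩; exact B_empty_gen K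
  · rintro rfl; exact ⟨∅, ⟨Finset.empty_subset _, rfl⟩, B_empty_gen K⟩

/-- **`Kr(D, f, 0) = 0` for `f ≠ 0`**: no scalar kills a non-zero class. -/
lemma Kr_zero_eq_bot (D : Finset I) {f : HT K I} (hf : f ≠ 0) : Kr K D f 0 = ⊥ := by
  rw [eq_bot_iff]
  intro θ hθ
  obtain ⟨hθH, hθf⟩ := mem_Kr.mp hθ
  rw [Hom_zero_eq_one, Submodule.one_eq_span, Submodule.mem_span_singleton] at hθH
  obtain ⟨c, rfl⟩ := hθH
  rw [smul_mul_assoc, one_mul, smul_eq_zero] at hθf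
  rw [Submodule.mem_bot, hθf.resolve_right hf, zero_smul]

/-- conversely `Kr(D, 0, 0) = Hom(D, 0) ≠ 0`: the scalar `1` kills the zero class. -/
lemma one_mem_Kr_zero (D : Finset I) : (1 : HT K I) ∈ Kr K D 0 0 :=
  mem_Kr.mpr ⟨by rw [Hom_zero_eq_one]; exact Submodule.one_le.mp le_rfl, mul_zero _⟩

/-- the three-term Künneth kernel sum in degree `≤ 2`, evaluated: `⨆ a ∈ range (k+1)` over `k ≤ 2` unfolds to the listed terms. -/
lemma krSum_zero (D₁ D₂ : Finset I) (f₁ f₂ : HT K I) :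
    krSum K D₁ D₂ f₁ f₂ 0 = Kr K D₁ f₁ 0 * Hom K I D₂ 0 ⊔ Hom K I D₁ 0 * Kr K D₂ f₂ 0 := by
  rw [krSum, zero_add, Finset.range_one, ← Finset.sup_eq_iSup, Finset.sup_singleton]

/-- degree `1` of the Künneth kernel sum. -/
lemma krSum_one (D₁ D₂ : Finset I) (f₁ f₂ : HT K I) :
    krSum K D₁ D₂ f₁ f₂ 1 = (Kr K D₁ f₁ 0 * Hom K I D₂ 1 ⊔ Hom K I D₁ 0 * Kr K D₂ f₂ 1) ⊔
      (Kr K D₁ f₁ 1 * Hom K I D₂ 0 ⊔ Hom K I D₁ 1 * Kr K D₂ f₂ 0) := by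
  rw [krSum, ← Finset.sup_eq_iSup, Finset.range_add_one, Finset.range_one, Finset.sup_insert, Finset.sup_singleton, sup_comm]

/-- degree `2` of the Künneth kernel sum. -/
lemma krSum_two (D₁ D₂ : Finset I) (f₁ f₂ : HT K I) :
    krSum K D₁ D₂ f₁ f₂ 2 = (Kr K D₁ f₁ 0 * Hom K I D₂ 2 ⊔ Hom K I D₁ 0 * Kr K D₂ f₂ 2) ⊔
      ((Kr K D₁ f₁ 1 * Hom K I D₂ 1 ⊔ Hom K I D₁ 1 * Kr K D₂ f₂ 1) ⊔
        (Kr K D₁ f₁ 2 * Hom K I D₂ 0 ⊔ Hom K I D₁ 2 * Kr K D₂ f₂ 0)) := by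
  rw [krSum, ← Finset.sup_eq_iSup, Finset.range_add_one, Finset.range_add_one, Finset.range_one, Finset.sup_insert,
    Finset.sup_insert, Finset.sup_singleton]
  simp only [Nat.sub_self, Nat.sub_zero, show 2 - 1 = 1 from rfl]
  rw [sup_comm (Kr K D₁ f₁ 2 * Hom K I D₂ 0 ⊔ Hom K I D₁ 2 * Kr K D₂ f₂ 0), sup_comm (Kr K D₁ f₁ 1 * _ ⊔ _), sup_assoc]

/-- **the product of two non-zero homogeneous classes on disjoint blocks is killed by no scalar** (`Kr(D₁ ⊔ D₂, f₁f₂, 0) = 0`;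
in particular `f₁ ∧ f₂ ≠ 0`). -/
theorem Kr_union_zero_eq_bot {D₁ D₂ : Finset I} (hD : Disjoint D₁ D₂) {d₁ d₂ : ℕ} {f₁ f₂ : HT K I}
    (hf₁ : f₁ ∈ Hom K I D₁ d₁) (hf₂ : f₂ ∈ Hom K I D₂ d₂) (h₁ : f₁ ≠ 0) (h₂ : f₂ ≠ 0) :
    Kr K (D₁ ∪ D₂) (f₁ * f₂) 0 = ⊥ := by
  rw [Kr_union_eq_krSum K hD hf₁ hf₂, krSum_zero, Kr_zero_eq_bot K D₁ h₁, Kr_zero_eq_bot K D₂ h₂, Submodule.bot_mul,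
    Submodule.mul_bot, bot_sup_eq]

/-- **`f₁ ∧ f₂ ≠ 0`** for non-zero homogeneous classes on disjoint blocks. -/
theorem mul_ne_zero_of_mem_Hom {D₁ D₂ : Finset I} (hD : Disjoint D₁ D₂) {d₁ d₂ : ℕ} {f₁ f₂ : HT K I}
    (hf₁ : f₁ ∈ Hom K I D₁ d₁) (hf₂ : f₂ ∈ Hom K I D₂ d₂) (h₁ : f₁ ≠ 0) (h₂ : f₂ ≠ 0) : f₁ * f₂ ≠ 0 := by
  intro h
  have h1 : (1 : HT K I) ∈ Kr K (D₁ ∪ D₂) (f₁ * f₂) 0 := by rw [h]; exact one_mem_Kr_zero K _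
  rw [Kr_union_zero_eq_bot K hD hf₁ hf₂ h₁ h₂, Submodule.mem_bot] at h1
  exact one_ne_zero h1

/-- **a product of two NON-DEGENERATE factors is non-degenerate: `Kr(D₁ ⊔ D₂, f₁f₂, 1) = 0`** when `f_i ≠ 0` and no `1`-form kills
`f_i` (`Kr(D_i, f_i, 1) = 0`). -/
theorem Kr_union_one_eq_bot {D₁ D₂ : Finset I} (hD : Disjoint D₁ D₂) {d₁ d₂ : ℕ} {f₁ f₂ : HT K I}
    (hf₁ : f₁ ∈ Hom K I D₁ d₁) (hf₂ : f₂ ∈ Hom K I D₂ d₂) (h₁ : f₁ ≠ 0) (h₂ : f₂ ≠ 0)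
    (hk₁ : Kr K D₁ f₁ 1 = ⊥) (hk₂ : Kr K D₂ f₂ 1 = ⊥) : Kr K (D₁ ∪ D₂) (f₁ * f₂) 1 = ⊥ := by
  rw [Kr_union_eq_krSum K hD hf₁ hf₂, krSum_one, Kr_zero_eq_bot K D₁ h₁, Kr_zero_eq_bot K D₂ h₂, hk₁, hk₂]
  simp only [Submodule.bot_mul, Submodule.mul_bot, bot_sup_eq]

/-- **THE DEGREE-2 KERNEL OF A BOX OF TWO NON-DEGENERATE FACTORS: `Kr(D₁ ⊔ D₂, f₁f₂, 2) = Kr(D₁, f₁, 2) ⊔ Kr(D₂, f₂, 2)`** —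
th-7 Cor. A.4's shape «`H¹(T_X) ⊗ 1 ⊕ 1 ⊗ H¹(T_{X′})`» for ARBITRARY homogeneous classes killed by no `1`-form: the mixed Künneth
directions `Hom(D₁,1) ∧ Hom(D₂,1)` never meet the degree-2 kernel. -/
theorem Kr_union_two_eq {D₁ D₂ : Finset I} (hD : Disjoint D₁ D₂) {d₁ d₂ : ℕ} {f₁ f₂ : HT K I}
    (hf₁ : f₁ ∈ Hom K I D₁ d₁) (hf₂ : f₂ ∈ Hom K I D₂ d₂) (h₁ : f₁ ≠ 0) (h₂ : f₂ ≠ 0)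
    (hk₁ : Kr K D₁ f₁ 1 = ⊥) (hk₂ : Kr K D₂ f₂ 1 = ⊥) :
    Kr K (D₁ ∪ D₂) (f₁ * f₂) 2 = Kr K D₁ f₁ 2 ⊔ Kr K D₂ f₂ 2 := by
  rw [Kr_union_eq_krSum K hD hf₁ hf₂, krSum_two, Kr_zero_eq_bot K D₁ h₁, Kr_zero_eq_bot K D₂ h₂, hk₁, hk₂, Hom_zero_eq_one K D₁,
    Hom_zero_eq_one K D₂]
  simp only [Submodule.bot_mul, Submodule.mul_bot, bot_sup_eq, sup_bot_eq, Submodule.one_mul, Submodule.mul_one]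
  rw [sup_comm]

/-- the two degree-2 factor kernels are DISJOINT (they live on different blocks), so the sum in `Kr_union_two_eq` is direct. -/
theorem Kr_two_inf_Kr_two_eq_bot {D₁ D₂ : Finset I} (hD : Disjoint D₁ D₂) (f₁ f₂ : HT K I) :
    Kr K D₁ f₁ 2 ⊓ Kr K D₂ f₂ 2 = ⊥ := by
  classical
  rw [eq_bot_iff]
  intro θ hθ
  obtain ⟨h1, h2⟩ := Submodule.mem_inf.mp hθ
  have hA : θ ∈ Alg K I D₁ := Hom_le_Alg K D₁ 2 (Kr_le_Hom K D₁ f₁ 2 h1)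
  rw [Submodule.mem_bot]
  refine eq_zero_of_coord_eq_zero K hA fun s hs => ?_
  by_cases hs2 : s ⊆ D₂ ∧ s.card = 2
  · exfalso
    obtain ⟨x, hx⟩ := Finset.card_pos.mp (by rw [hs2.2]; omega)
    exact Finset.disjoint_left.mp hD (hs hx) (hs2.1 hx)
  · exact coord_eq_zero_of_mem_Hom K (Kr_le_Hom K D₂ f₂ 2 h2) hs2

/-- hence **`dim Kr(D₁ ⊔ D₂, f₁f₂, 2) = dim Kr(D₁, f₁, 2) + dim Kr(D₂, f₂, 2)`** for two non-degenerate factors. -/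
theorem finrank_Kr_union_two {D₁ D₂ : Finset I} (hD : Disjoint D₁ D₂) {d₁ d₂ : ℕ} {f₁ f₂ : HT K I}
    (hf₁ : f₁ ∈ Hom K I D₁ d₁) (hf₂ : f₂ ∈ Hom K I D₂ d₂) (h₁ : f₁ ≠ 0) (h₂ : f₂ ≠ 0)
    (hk₁ : Kr K D₁ f₁ 1 = ⊥) (hk₂ : Kr K D₂ f₂ 1 = ⊥) :
    finrank K (Kr K (D₁ ∪ D₂) (f₁ * f₂) 2) = finrank K (Kr K D₁ f₁ 2) + finrank K (Kr K D₂ f₂ 2) := by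
  rw [Kr_union_two_eq K hD hf₁ hf₂ h₁ h₂ hk₁ hk₂, ← Submodule.finrank_sup_add_finrank_inf_eq,
    Kr_two_inf_Kr_two_eq_bot K hD, finrank_bot, add_zero]

/-! ## §3. Any finite splitting: the recursive kernel law and the degree-2 kernel of a box of `n` non-degenerate factors -/

section Split

variable {n : ℕ} {D : ℕ → Finset I} {d : ℕ → ℕ} {f : ℕ → HT K I}

/-- **THE RECURSIVE KÜNNETH KERNEL LAW over a finite splitting**: for pairwise disjoint blocks `D 0, …, D (n−1)` and homogeneous
`f i ∈ Hom(D i, d i)`, the kernel of the prefix product `f 0 ∧ ⋯ ∧ f j` (`1 ≤ j < n`) in every degree is the Künneth kernel sum of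
the previous prefix product and the new factor. -/
theorem Kr_prodR_succ (hf : ∀ i, i < n → f i ∈ Hom K I (D i) (d i)) (hD : ∀ i j, i < j → j < n → Disjoint (D i) (D j))
    {j : ℕ} (hj1 : 1 ≤ j) (hjn : j < n) (k : ℕ) :
    Kr K ((Finset.range (j + 1)).biUnion D) (prodR K f (j + 1)) k =
      krSum K ((Finset.range j).biUnion D) (D j) (prodR K f j) (f j) k := by
  rw [biUnion_range_succ, prodR_succ]
  exact Kr_union_eq_krSum K (disjoint_biUnion_range hD hjn) (rankPoly_prodR K hf hD j hj1 hjn.le).1 (hf j hjn) k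

/-- **PREFIX PRODUCTS OF NON-DEGENERATE FACTORS ARE NON-DEGENERATE** (`1 ≤ j ≤ n`): killed by no scalar and by no `1`-form. -/
theorem Kr_prodR_low (hf : ∀ i, i < n → f i ∈ Hom K I (D i) (d i)) (hD : ∀ i j, i < j → j < n → Disjoint (D i) (D j))
    (h0 : ∀ i, i < n → f i ≠ 0) (h1 : ∀ i, i < n → Kr K (D i) (f i) 1 = ⊥) :
    ∀ j, 1 ≤ j → j ≤ n → prodR K f j ≠ 0 ∧ Kr K ((Finset.range j).biUnion D) (prodR K f j) 1 = ⊥ := by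
  intro j hj1 hjn
  induction j with
  | zero => omega
  | succ j ih =>
    have hj : j < n := by omega
    rcases Nat.eq_zero_or_pos j with rfl | hjpos
    · rw [prodR_one, zero_add, Finset.range_one, Finset.singleton_biUnion]
      exact ⟨h0 0 hj, h1 0 hj⟩
    · obtain ⟨hne, hone⟩ := ih hjpos hj.le
      have hHom := (rankPoly_prodR K hf hD j hjpos hj.le).1
      have hdis := disjoint_biUnion_range hD hj
      refine ⟨?_, ?_⟩
      · rw [prodR_succ]
        exact mul_ne_zero_of_mem_Hom K hdis hHom (hf j hj) hne (h0 j hj)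
      · rw [biUnion_range_succ, prodR_succ]
        exact Kr_union_one_eq_bot K hdis hHom (hf j hj) hne (h0 j hj) hone (h1 j hj)

/-- **THE DEGREE-2 KERNEL OF A BOX OF `n` NON-DEGENERATE FACTORS: `Kr(⋃_{i<j} D_i, f 0 ∧ ⋯ ∧ f (j−1), 2) = ⊔_{i<j} Kr(D_i, f_i, 2)`**
for every `1 ≤ j ≤ n` — uniformly in the number of factors, their blocks and their degrees: the degree-2 kernel of an external
product is the sum of the factors' degree-2 kernels; NO mixed direction is ever killed. -/
theorem Kr_prodR_two (hf : ∀ i, i < n → f i ∈ Hom K I (D i) (d i)) (hD : ∀ i j, i < j → j < n → Disjoint (D i) (D j))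
    (h0 : ∀ i, i < n → f i ≠ 0) (h1 : ∀ i, i < n → Kr K (D i) (f i) 1 = ⊥) :
    ∀ j, 1 ≤ j → j ≤ n →
      Kr K ((Finset.range j).biUnion D) (prodR K f j) 2 = ⨆ i ∈ Finset.range j, Kr K (D i) (f i) 2 := by
  classical
  intro j hj1 hjn
  induction j with
  | zero => omega
  | succ j ih =>
    have hj : j < n := by omega
    rcases Nat.eq_zero_or_pos j with rfl | hjpos
    · rw [prodR_one, zero_add, Finset.range_one, Finset.singleton_biUnion, ← Finset.sup_eq_iSup, Finset.sup_singleton]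
    · have hHom := (rankPoly_prodR K hf hD j hjpos hj.le).1
      have hdis := disjoint_biUnion_range hD hj
      obtain ⟨hne, hone⟩ := Kr_prodR_low K hf hD h0 h1 j hjpos hj.le
      rw [biUnion_range_succ, prodR_succ, Kr_union_two_eq K hdis hHom (hf j hj) hne (h0 j hj) hone (h1 j hj), ih hjpos hj.le,
        Finset.range_add_one, Finset.iSup_insert, sup_comm]

/-- and its DIMENSION adds up: **`dim Kr(⋃_{i<j} D_i, f 0 ∧ ⋯ ∧ f (j−1), 2) = Σ_{i<j} dim Kr(D_i, f_i, 2)`** (`1 ≤ j ≤ n`; the factor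
kernels live on pairwise disjoint blocks, so the sum is direct — counted one factor at a time). -/
theorem finrank_Kr_prodR_two (hf : ∀ i, i < n → f i ∈ Hom K I (D i) (d i)) (hD : ∀ i j, i < j → j < n → Disjoint (D i) (D j))
    (h0 : ∀ i, i < n → f i ≠ 0) (h1 : ∀ i, i < n → Kr K (D i) (f i) 1 = ⊥) :
    ∀ j, 1 ≤ j → j ≤ n →
      finrank K (Kr K ((Finset.range j).biUnion D) (prodR K f j) 2) = ∑ i ∈ Finset.range j, finrank K (Kr K (D i) (f i) 2) := by
  intro j hj1 hjn
  induction j with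
  | zero => omega
  | succ j ih =>
    have hj : j < n := by omega
    rcases Nat.eq_zero_or_pos j with rfl | hjpos
    · rw [prodR_one, zero_add, Finset.range_one, Finset.singleton_biUnion, Finset.sum_singleton]
    · have hHom := (rankPoly_prodR K hf hD j hjpos hj.le).1
      have hdis := disjoint_biUnion_range hD hj
      obtain ⟨hne, hone⟩ := Kr_prodR_low K hf hD h0 h1 j hjpos hj.le
      rw [biUnion_range_succ, prodR_succ, finrank_Kr_union_two K hdis hHom (hf j hj) hne (h0 j hj) hone (h1 j hj), ih hjpos hj.le,
        Finset.sum_range_succ]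

end Split

end Summit.Ventures.HSemireg.Wedge.KunnethKernel
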